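import Literature.NumberTheory.LFunctions.KMVMomentAsymptoticsBeyondDiagonal
import HarnessLib

/-!
# The diagonal-only model beyond the diagonal: KMV's one-piece value exceeds `¼` exactly when the
length exceeds the diagonal (Kowalski–Michel–VanderKam 2000, Thm. 6.1 / §7, `P = X²`)

Topic `Literature/NumberTheory/LFunctions` (cell landau-siegel, family B-fam). A RUNG for the
family route `PrimeLevelFamEdge` (crux `BeyondDiagonalBeatsQuarter`), stated in the tree's KMV
vocabulary (`KMV2000.envelope`, `ratio`, `linForm`, `secondMomentForm`, `Admissible`,
`MomentAsymptoticsDiagOnly`; all of `KMVMollifiedMomentForms` / `KMVMomentAsymptoticsBeyondDiagonal`)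
and PROVED, 0 facts. Source of the shapes: the Cauchy–Schwarz value
`R(P,Q) = (main term of L^h)² / (main term of Q^h) = linForm²/(2·secondMomentForm)` of
[KowalskiMichelVanderKam2000, Thm. 6.1 (32)], whose supremum over admissible `P` at `Q = 1` and
length `Δ` is the envelope `Δ/(2(1+Δ))` (`KMV2000.ratio_one_le`, attained by `P = X²`,
`KMV2000.ratio_one_X_sq`; KMV §7 / footnote 2: "`p₀ ≥ 1/4` … if we let `Δ → 1`").

WHAT IS PROVED.
* `quarter_lt_envelope'` — `1 < Δ → 1/4 < Δ/(2(1+Δ))` (from the tree's `envelope_lt_quarter_iff` /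
  `envelope_eq_quarter_iff`); the same arithmetic as `Zhang2022.Repair.quarter_lt_envelope`
  (intake file, not imported here to keep the literature cone below the intake).
* `beyondDiagonalBeatsQuarter_diagOnlyModel` — in the DIAGONAL-ONLY model (`T₁ = T₂ = 0`, the
  design map's flagged guess for famE-02; the GRH-conditional shape attributed to Iwaniec–Sarnak
  at KMV p. 28) the VALUE crux's conclusion holds on the whole window `(1, Δ)` with `P = X²`:
  `∃ b, 1 < b ≤ Δ, ∃ P admissible, ∀ Δ' ∈ (1, b), 1/4 < (linForm Δ' P 1 + 0)²/(2·(secondMomentForm Δ' P 1 + 0))`.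
* `beyondDiagonalBeatsQuarter_of_diagOnly` — the same phrased through `MomentAsymptoticsDiagOnly 1 Δ`
  (the hypothesis is not even used: the content of the real crux is that the TRUE off-diagonal main
  terms `T₁, T₂` do not destroy the value).
* `no_profile_beats_quarter_inside` — contrast, the printed side: inside the printed range
  `0 < Δ' < 1` no admissible profile reaches `¼` (`KMV2000.ratio_one_lt_quarter`).

WHAT THIS IS NOT: no claim about the moment asymptotics beyond the diagonal (OPEN IN PRINT at a
fixed level, registry famE-02), about `E*-fam`, or about Landau–Siegel zeros. «The programme
SEARCHES and TYPES; no claim about Landau–Siegel zeros, Theorems 1–2 of arXiv:2211.02515 or a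
repaired Margin232 until a kernel theorem says so.»

## References

* [KowalskiMichelVanderKam2000] E. Kowalski, P. Michel, J. VanderKam, J. reine angew. Math. 526
  (2000) 1–34: Thm. 6.1 (32), §7 (`π_k`, the optimal `P_k`), §2 footnote 2, §8.4 p. 28 (the range
  `Δ < 1` and "[I-S] … assuming GRH"). [held: paper:doi-10-1515-crll-2000-074 p0020, p0028]
-/

noncomputable section

open Polynomial

namespace Literature.NumberTheory.LFunctions.KMV2000

/-- `1/4 < Δ/(2(1+Δ))` for `Δ > 1`: the one-piece envelope passes the quarter exactly beyond the
diagonal (`envelope_lt_quarter_iff`: `< ¼ ⟺ Δ < 1`; `envelope_eq_quarter_iff`: `= ¼ ⟺ Δ = 1`).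
[cite: KowalskiMichelVanderKam2000, §2 footnote 2; Thm. 6.1 (32)] -/
theorem quarter_lt_envelope' {Δ : ℝ} (hΔ : 1 < Δ) : 1 / 4 < envelope Δ := by
  have h0 : 0 ≤ Δ := by linarith
  rcases lt_trichotomy (1 / 4 : ℝ) (envelope Δ) with h | h | h
  · exact h
  · exact absurd ((envelope_eq_quarter_iff h0).1 h.symm) (by linarith)
  · exact absurd ((envelope_lt_quarter_iff h0).1 h) (by linarith)

/-- **Rung (diagonal-only model of the VALUE crux).** With `T₁ = T₂ = 0` the conclusion of the
route's crux `BeyondDiagonalBeatsQuarter` holds on the whole window `(1, Δ)` (initial segment with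
`b = Δ`) with the profile `P = X²`, whose value is the envelope `Δ'/(2(1+Δ')) > ¼`
(`ratio_one_X_sq`). [cite: KowalskiMichelVanderKam2000, Thm. 6.1 (32); §2 footnote 2] -/
theorem beyondDiagonalBeatsQuarter_diagOnlyModel (Δ : ℝ) (hΔ : 1 < Δ) :
    ∃ b : ℝ, 1 < b ∧ b ≤ Δ ∧ ∃ P : ℝ[X], Admissible P ∧
      ∀ Δ' : ℝ, 1 < Δ' → Δ' < b →
        1 / 4 < (linForm Δ' P 1 + (fun _ _ _ ↦ (0 : ℝ)) Δ' P 1) ^ 2 /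
          (2 * (secondMomentForm Δ' P 1 + (fun _ _ _ ↦ (0 : ℝ)) Δ' P 1)) := by
  refine ⟨Δ, hΔ, le_rfl, X ^ 2, admissible_X_sq, fun Δ' h1 _ ↦ ?_⟩
  simp only [add_zero]
  have h := ratio_one_X_sq (Δ := Δ') (by linarith)
  unfold ratio at h
  rw [h]
  exact quarter_lt_envelope' h1

/-- The same rung phrased through `MomentAsymptoticsDiagOnly 1 Δ`: in the diagonal-only model the
VALUE crux's conclusion holds for every window beyond the diagonal (the hypothesis is not used —
the content of the real crux is that the TRUE `T₁, T₂` do not destroy this).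
[cite: KowalskiMichelVanderKam2000, Thm. 6.1 (32); §6 p. 19] -/
theorem beyondDiagonalBeatsQuarter_of_diagOnly (Δ : ℝ) (hΔ : 1 < Δ)
    (_h : MomentAsymptoticsDiagOnly 1 Δ) :
    ∃ b : ℝ, 1 < b ∧ b ≤ Δ ∧ ∃ P : ℝ[X], Admissible P ∧
      ∀ Δ' : ℝ, 1 < Δ' → Δ' < b →
        1 / 4 < (linForm Δ' P 1 + (fun _ _ _ ↦ (0 : ℝ)) Δ' P 1) ^ 2 /
          (2 * (secondMomentForm Δ' P 1 + (fun _ _ _ ↦ (0 : ℝ)) Δ' P 1)) :=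
  beyondDiagonalBeatsQuarter_diagOnlyModel Δ hΔ

/-- Contrast (the printed side of the ladder): INSIDE the printed range `0 < Δ' < 1` no admissible
profile reaches `¼` (`ratio_one_lt_quarter`) — the one-piece ceiling the route must beat.
[cite: KowalskiMichelVanderKam2000, Thm. 6.1 (32); §8.4 p. 28 (range Δ < 1)] -/
theorem no_profile_beats_quarter_inside {Δ' : ℝ} (h0 : 0 < Δ') (h1 : Δ' < 1) {P : ℝ[X]}
    (hP : Admissible P) : ratio Δ' P 1 < 1 / 4 :=
  ratio_one_lt_quarter h0 h1 hP

end Literature.NumberTheory.LFunctions.KMV2000
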